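import Summits.CriticalPhenomena.PercolationContinuityZ3.Theorems.PercAnnulusCrossingNoiseSplice
import HarnessLib

/-!
# RSW3 lane (lead, gen 20): NOISE SENSITIVITY OF CROSSINGS, III — THE SCHRAMM–STEIF REVEALMENT THEOREM on the p-biased cube:
# `Σ_{|S|=k} f̂(S)² ≤ k·δ·E_p[f²]` for a finite mixture of decision trees computing `f` with revealment `δ`

builds on p205010 (kernel theorem, internal audit signed; external expert review pending) — NOT used in this file (abstract).

Cell `prim-rsw3` (LANE 3), lead seat, gen 20.  Support file (`--supports stmt-CriticalPhenomena-4575`); no definitions, no named facts,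
no sorries.  Setting of parts I–II (`…NoiseFourier`, `…NoiseSplice`): finite product cube `ι → Bool`, biases `p ∈ [0,1]^ι`, weight `wt p`,
a character system `r` ((H1), (H2)), characters `χ_S = Π_{i∈S} r_i` and coefficients `f̂(S) = E_p[f·χ_S]` written out.  A RANDOMIZED ALGORITHM
is a finite family of reduced decision trees `T_t` (`DecTree`) with probability weights `q_t ≥ 0`, `Σ_t q_t = 1`, each computing `f`
(`(T_t).eval = f`); its REVEALMENT is any `δ ≥ max_i Σ_t q_t·P_p(i ∈ J_t)`, `J_t(x) = (T_t).queried x`.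

* `two_mul_mul_le_of_pos` — `2ab ≤ s a² + b²/s` (`s > 0`).
* **`level_weight_le_revealment`** — SCHRAMM–STEIF (Thm 1.8), every `k ≥ 1`: **`Σ_{|S|=k} f̂(S)² ≤ k·δ·E_p[f²]`**.
  Proof (Garban–Steif Ch. VIII §2, in finite sums): with `g = Σ_{|S|=k} f̂(S)χ_S` and `G_t(x) = E_y g(splice_{T_t}(x,y))`:
  `W := Σ f̂(S)² = E[f g] = E[f G_t]` (re-randomisation + `eval_splice`); Bessel at each `x` for the family `{1} ∪ {χ_S : |S| = k, S ∩ J_t(x) = ∅}`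
  and re-randomisation give `E[G_t²] + Σ_S f̂(S)² P(S ∩ J_t = ∅) ≤ E[g²] = W`, so `Σ_t q_t E[G_t²] ≤ Σ_S f̂(S)² Σ_{i∈S} P(i revealed) ≤ kδW`;
  finally `2W = 2Σ_t q_t E[f G_t] ≤ s E[f²] + Σ_t q_t E[G_t²]/s` with `s = kδ`.
* **`low_level_weight_le_revealment`** — summed over the levels `1 ≤ k ≤ m`: **`Σ_{k=1}^{m} Σ_{|S|=k} f̂(S)² ≤ m²·δ·E_p[f²]`**.

References: O. Schramm, J. Steif, *Quantitative noise sensitivity and exceptional times for percolation*, Ann. of Math. 171 (2010) 619–672,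
Thm 1.8; C. Garban, J. Steif, *Noise sensitivity of Boolean functions and percolation*, CUP 2014, Ch. VIII Thm VIII.1 and its proof;
R. O'Donnell, M. Saks, O. Schramm, R. Servedio, FOCS 2005 (revealment `δ_i = Pr[T queries x_i]`).
-/

noncomputable section

namespace Summit.CriticalPhenomena.PercolationContinuityZ3.Theorems.Crossing.Spectral

open Finset Function
open Literature.Probability.ODonnellSaksSchrammServedio2005

/-! ## §3 The Schramm–Steif revealment theorem -/

section SchrammSteif

variable {ι : Type*} [Fintype ι] [DecidableEq ι]

/-- `2·a·b ≤ s·a² + b²/s` for `s > 0` (the Cauchy–Schwarz step of the proof, in AM–GM form). [folklore] -/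
theorem two_mul_mul_le_of_pos {s : ℝ} (hs : 0 < s) (a b : ℝ) : 2 * (a * b) ≤ s * (a * a) + (b * b) / s := by
  have h1 : s * (a * a) + (b * b) / s - 2 * (a * b) = (s * a - b) ^ 2 / s := by
    field_simp
    ring
  have h2 : 0 ≤ (s * a - b) ^ 2 / s := div_nonneg (sq_nonneg _) hs.le
  linarith

/-- **THE SCHRAMM–STEIF REVEALMENT THEOREM** on the p-biased cube (`p ∈ [0,1]^ι`, any character system `r`): if the reduced trees `T_t`,
mixed with probability weights `q_t`, all compute `f`, and every coordinate is queried with (mixed) probability at most `δ`, then for every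
`k ≥ 1` the level-`k` Fourier weight of `f` satisfies **`Σ_{|S|=k} f̂(S)² ≤ k·δ·E_p[f²]`**.
[cite: SchrammSteif2010, Thm 1.8] [cite: GarbanSteif2014, Ch. VIII Thm VIII.1 and proof] -/
theorem level_weight_le_revealment (p : ι → ℝ) (h0 : ∀ i, 0 ≤ p i) (h1 : ∀ i, p i ≤ 1) {r : ι → Bool → ℝ}
    (hH1 : ∀ i, p i * r i true + (1 - p i) * r i false = 0)
    (hH2 : ∀ i (b b' : Bool), coordWt p i b ≠ 0 → coordWt p i b' * (1 + r i b * r i b') = if b' = b then 1 else 0)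
    (f : (ι → Bool) → ℝ) {τ : Type*} [Fintype τ] (q : τ → ℝ) (hq0 : ∀ t, 0 ≤ q t) (hq1 : ∑ t, q t = 1)
    (T : τ → DecTree ι) (hT : ∀ t, (T t).Reduced) (hf : ∀ t x, (T t).eval x = f x) {k : ℕ} (hk : 1 ≤ k) {δ : ℝ}
    (hδ0 : 0 ≤ δ) (hδ : ∀ i, ∑ t, q t * ∑ x : ι → Bool, wt p x * (if i ∈ (T t).queried x then (1 : ℝ) else 0) ≤ δ) :
    ∑ S ∈ (Finset.univ : Finset ι).powersetCard k, (∑ x : ι → Bool, wt p x * (f x * ∏ i ∈ S, r i (x i))) ^ 2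
      ≤ k * δ * ∑ x : ι → Bool, wt p x * (f x * f x) := by
  -- notation: coefficients `a`, the level `𝒮`, the level-`k` part `g`, the weight `W`
  obtain ⟨a, ha⟩ : ∃ a : Finset ι → ℝ, a = fun S => ∑ x : ι → Bool, wt p x * (f x * ∏ i ∈ S, r i (x i)) := ⟨_, rfl⟩
  set 𝒮 : Finset (Finset ι) := (Finset.univ : Finset ι).powersetCard k with h𝒮
  obtain ⟨g, hg⟩ : ∃ g : (ι → Bool) → ℝ, g = fun x => ∑ S ∈ 𝒮, a S * ∏ i ∈ S, r i (x i) := ⟨_, rfl⟩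
  set W : ℝ := ∑ S ∈ 𝒮, (∑ x : ι → Bool, wt p x * (f x * ∏ i ∈ S, r i (x i))) ^ 2 with hWdef
  have hW : W = ∑ S ∈ 𝒮, a S * a S := Finset.sum_congr rfl fun S _ => by rw [ha]; ring
  have hwt0 : ∀ x : ι → Bool, 0 ≤ wt p x := wt_nonneg h0 h1
  have hcard : ∀ S ∈ 𝒮, S.card = k := fun S hS => (Finset.mem_powersetCard.1 hS).2
  have hne : ∀ S ∈ 𝒮, S ≠ ∅ := by
    intro S hS hS0; have := hcard S hS; rw [hS0, Finset.card_empty] at this; omega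
  -- `E[g χ_S] = a_S` on the level, `‖g‖² = W`, `E[f g] = W`
  have hgS : ∀ S ∈ 𝒮, ∑ x : ι → Bool, wt p x * (g x * ∏ i ∈ S, r i (x i)) = a S := by
    intro S hS
    calc ∑ x : ι → Bool, wt p x * (g x * ∏ i ∈ S, r i (x i))
        = ∑ U ∈ 𝒮, a U * ∑ x : ι → Bool, wt p x * ((∏ i ∈ U, r i (x i)) * ∏ i ∈ S, r i (x i)) := by
          simp only [hg, Finset.sum_mul, Finset.mul_sum]
          rw [Finset.sum_comm]
          exact Finset.sum_congr rfl fun U _ => Finset.sum_congr rfl fun x _ => by ring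
      _ = a S * ∑ x : ι → Bool, wt p x * ((∏ i ∈ S, r i (x i)) * ∏ i ∈ S, r i (x i)) := by
          rw [Finset.sum_eq_single_of_mem S hS]
          intro U _ hUS
          rw [sum_wt_mul_char_mul_char hH1 hUS, mul_zero]
      _ = a S := by rw [ha]; exact coeff_mul_sum_wt_char_sq h0 h1 hH2 f S
  have hgg : ∑ x : ι → Bool, wt p x * (g x * g x) = W := by
    calc ∑ x : ι → Bool, wt p x * (g x * g x) = ∑ S ∈ 𝒮, a S * ∑ x : ι → Bool, wt p x * (g x * ∏ i ∈ S, r i (x i)) := by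
          conv_lhs => arg 2; ext x; rw [show g x * g x = g x * ∑ S ∈ 𝒮, a S * ∏ i ∈ S, r i (x i) by rw [hg]]
          simp only [Finset.mul_sum]
          rw [Finset.sum_comm]
          exact Finset.sum_congr rfl fun S _ => Finset.sum_congr rfl fun x _ => by ring
      _ = W := by rw [hW]; exact Finset.sum_congr rfl fun S hS => by rw [hgS S hS]
  have hfg : ∑ x : ι → Bool, wt p x * (f x * g x) = W := by
    calc ∑ x : ι → Bool, wt p x * (f x * g x) = ∑ S ∈ 𝒮, a S * ∑ x : ι → Bool, wt p x * (f x * ∏ i ∈ S, r i (x i)) := by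
          conv_lhs => arg 2; ext x; rw [show f x * g x = f x * ∑ S ∈ 𝒮, a S * ∏ i ∈ S, r i (x i) by rw [hg]]
          simp only [Finset.mul_sum]
          rw [Finset.sum_comm]
          exact Finset.sum_congr rfl fun S _ => Finset.sum_congr rfl fun x _ => by ring
      _ = W := by rw [hW]; exact Finset.sum_congr rfl fun S _ => by rw [ha]
  -- the conditional expectations `G_t(x) = E_y g(splice_t(x,y))`
  obtain ⟨G, hG⟩ : ∃ G : τ → (ι → Bool) → ℝ,
      G = fun t x => ∑ y : ι → Bool, wt p y * g (fun j => if j ∈ (T t).queried x then x j else y j) := ⟨_, rfl⟩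
  -- STEP 1: `W = E[f G_t]` for every `t`
  have step1 : ∀ t, ∑ x : ι → Bool, wt p x * (f x * G t x) = W := by
    intro t
    rw [← hfg, ← sum_sum_wt_splice p (T t) (hT t) (fun z => f z * g z)]
    simp only [hG, Finset.mul_sum]
    refine Finset.sum_congr rfl fun x _ => Finset.sum_congr rfl fun y _ => ?_
    rw [← hf t (fun j => if j ∈ (T t).queried x then x j else y j), eval_splice, hf t x]
    ring
  -- STEP 2: `E[G_t²] + Σ_S a_S² P(S ∩ J_t = ∅) ≤ W` for every `t` (Bessel at each `x`, then re-randomisation)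
  have step2 : ∀ t, (∑ x : ι → Bool, wt p x * (G t x * G t x))
      + ∑ S ∈ 𝒮, a S * a S * ∑ x : ι → Bool, wt p x * (if Disjoint S ((T t).queried x) then (1 : ℝ) else 0) ≤ W := by
    intro t
    -- pointwise Bessel for the family `{∅} ∪ {S ∈ 𝒮 : S ∩ J_t(x) = ∅}`
    have hpt : ∀ x : ι → Bool, G t x * G t x + ∑ S ∈ 𝒮, a S * a S * (if Disjoint S ((T t).queried x) then (1 : ℝ) else 0)
        ≤ ∑ y : ι → Bool, wt p y * (g (fun j => if j ∈ (T t).queried x then x j else y j)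
            * g (fun j => if j ∈ (T t).queried x then x j else y j)) := by
      intro x
      have hBessel := sum_sq_inner_le_of_orthogonal (wt p) hwt0 (insert ∅ (𝒮.filter fun S => Disjoint S ((T t).queried x)))
        (fun S y => ∏ i ∈ S, r i (y i)) (fun S _ S' _ hSS' => sum_wt_mul_char_mul_char hH1 hSS')
        (fun S _ => sum_wt_mul_char_sq_le_one h0 h1 hH2 S) (fun y => g (fun j => if j ∈ (T t).queried x then x j else y j))
      have h0A : ∅ ∉ 𝒮.filter (fun S => Disjoint S ((T t).queried x)) := fun h => hne ∅ (Finset.mem_filter.1 h).1 rfl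
      rw [Finset.sum_insert h0A] at hBessel
      simp only [Finset.prod_empty, mul_one] at hBessel
      -- the inner products with `χ_S`, `S ∈ 𝒮`, `S ∩ J = ∅`, are `a_S`
      have hinner : ∀ S ∈ 𝒮.filter (fun S => Disjoint S ((T t).queried x)),
          ∑ y : ι → Bool, wt p y * (g (fun j => if j ∈ (T t).queried x then x j else y j) * ∏ i ∈ S, r i (y i)) = a S := by
        intro S hS
        obtain ⟨hS𝒮, hSJ⟩ := Finset.mem_filter.1 hS
        calc ∑ y : ι → Bool, wt p y * (g (fun j => if j ∈ (T t).queried x then x j else y j) * ∏ i ∈ S, r i (y i))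
            = ∑ U ∈ 𝒮, a U * ∑ y : ι → Bool, wt p y *
                ((∏ i ∈ U, r i (if i ∈ (T t).queried x then x i else y i)) * ∏ i ∈ S, r i (y i)) := by
              simp only [hg, Finset.sum_mul, Finset.mul_sum]
              rw [Finset.sum_comm]
              exact Finset.sum_congr rfl fun U _ => Finset.sum_congr rfl fun y _ => by ring
          _ = a S * ∑ y : ι → Bool, wt p y * ((∏ i ∈ S, r i (y i)) * ∏ i ∈ S, r i (y i)) := by
              rw [Finset.sum_eq_single_of_mem S hS𝒮]
              · rw [sum_wt_char_splice_mul_char hH1 _ S S x hSJ rfl, if_pos rfl]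
              · intro U hU hUS
                rw [sum_wt_char_splice_mul_char hH1 _ U S x hSJ (by rw [hcard U hU, hcard S hS𝒮]), if_neg hUS, mul_zero]
          _ = a S := by rw [ha]; exact coeff_mul_sum_wt_char_sq h0 h1 hH2 f S
      have hsum2 : ∑ S ∈ 𝒮.filter (fun S => Disjoint S ((T t).queried x)),
          (∑ y : ι → Bool, wt p y * (g (fun j => if j ∈ (T t).queried x then x j else y j) * ∏ i ∈ S, r i (y i))) ^ 2
          = ∑ S ∈ 𝒮, a S * a S * (if Disjoint S ((T t).queried x) then (1 : ℝ) else 0) := by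
        rw [Finset.sum_filter]
        refine Finset.sum_congr rfl fun S hS => ?_
        split_ifs with hd
        · rw [hinner S (Finset.mem_filter.2 ⟨hS, hd⟩)]; ring
        · ring
      rw [hsum2] at hBessel
      have hGx : G t x = ∑ y : ι → Bool, wt p y * g (fun j => if j ∈ (T t).queried x then x j else y j) := by
        simp only [hG]
      rw [hGx, ← sq]
      exact hBessel
    -- integrate over `x`
    have hsum := Finset.sum_le_sum fun x (_ : x ∈ (Finset.univ : Finset (ι → Bool))) => mul_le_mul_of_nonneg_left (hpt x) (hwt0 x)
    have hR : ∑ x : ι → Bool, wt p x * ∑ y : ι → Bool, wt p y * (g (fun j => if j ∈ (T t).queried x then x j else y j)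
        * g (fun j => if j ∈ (T t).queried x then x j else y j)) = W := by
      rw [← hgg, ← sum_sum_wt_splice p (T t) (hT t) (fun z => g z * g z)]
      refine Finset.sum_congr rfl fun x _ => ?_
      rw [Finset.mul_sum]
      exact Finset.sum_congr rfl fun y _ => by ring
    rw [hR] at hsum
    have hL : ∑ x : ι → Bool, wt p x * (G t x * G t x + ∑ S ∈ 𝒮, a S * a S * (if Disjoint S ((T t).queried x) then (1 : ℝ) else 0))
        = (∑ x : ι → Bool, wt p x * (G t x * G t x))
          + ∑ S ∈ 𝒮, a S * a S * ∑ x : ι → Bool, wt p x * (if Disjoint S ((T t).queried x) then (1 : ℝ) else 0) := by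
      simp only [mul_add, Finset.sum_add_distrib, Finset.mul_sum]
      congr 1
      rw [Finset.sum_comm]
      exact Finset.sum_congr rfl fun S _ => Finset.sum_congr rfl fun x _ => by ring
    rw [hL] at hsum
    exact hsum
  -- STEP 3: average over `t`: `Σ_t q_t E[G_t²] ≤ k δ W`
  have step3 : ∑ t, q t * ∑ x : ι → Bool, wt p x * (G t x * G t x) ≤ k * δ * W := by
    -- `E[G_t²] ≤ Σ_S a_S² P(S ∩ J_t ≠ ∅) ≤ Σ_S a_S² Σ_{i∈S} P(i ∈ J_t)`
    have hP : ∀ t, ∑ x : ι → Bool, wt p x * (G t x * G t x)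
        ≤ ∑ S ∈ 𝒮, a S * a S * ∑ i ∈ S, ∑ x : ι → Bool, wt p x * (if i ∈ (T t).queried x then (1 : ℝ) else 0) := by
      intro t
      have h2 := step2 t
      -- `W − Σ_S a_S² P(disjoint) = Σ_S a_S² P(not disjoint)`
      have hcompl : ∀ S ∈ 𝒮, a S * a S - a S * a S * ∑ x : ι → Bool, wt p x * (if Disjoint S ((T t).queried x) then (1 : ℝ) else 0)
          = a S * a S * ∑ x : ι → Bool, wt p x * (if Disjoint S ((T t).queried x) then (0 : ℝ) else 1) := by
        intro S _
        have : ∑ x : ι → Bool, wt p x * (if Disjoint S ((T t).queried x) then (0 : ℝ) else 1)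
            = 1 - ∑ x : ι → Bool, wt p x * (if Disjoint S ((T t).queried x) then (1 : ℝ) else 0) := by
          have hs : (∑ x : ι → Bool, wt p x * (if Disjoint S ((T t).queried x) then (0 : ℝ) else 1))
              + ∑ x : ι → Bool, wt p x * (if Disjoint S ((T t).queried x) then (1 : ℝ) else 0) = 1 := by
            rw [← Finset.sum_add_distrib]
            calc ∑ x : ι → Bool, (wt p x * (if Disjoint S ((T t).queried x) then (0 : ℝ) else 1)
                  + wt p x * (if Disjoint S ((T t).queried x) then (1 : ℝ) else 0))
                = ∑ x : ι → Bool, wt p x := Finset.sum_congr rfl fun x _ => by split_ifs <;> ring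
              _ = 1 := sum_wt p
          linarith
        rw [this]; ring
      have hunion : ∀ S ∈ 𝒮, ∑ x : ι → Bool, wt p x * (if Disjoint S ((T t).queried x) then (0 : ℝ) else 1)
          ≤ ∑ i ∈ S, ∑ x : ι → Bool, wt p x * (if i ∈ (T t).queried x then (1 : ℝ) else 0) := by
        intro S _
        rw [Finset.sum_comm]
        refine Finset.sum_le_sum fun x _ => ?_
        rw [← Finset.mul_sum]
        refine mul_le_mul_of_nonneg_left ?_ (hwt0 x)
        have hnn : ∀ j ∈ S, (0 : ℝ) ≤ (if j ∈ (T t).queried x then (1 : ℝ) else 0) := fun j _ => by split_ifs <;> norm_num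
        split_ifs with hdisj
        · exact Finset.sum_nonneg hnn
        · obtain ⟨i, hiS, hiJ⟩ := Finset.not_disjoint_iff.1 hdisj
          calc (1 : ℝ) = (if i ∈ (T t).queried x then (1 : ℝ) else 0) := by rw [if_pos hiJ]
            _ ≤ ∑ i ∈ S, (if i ∈ (T t).queried x then (1 : ℝ) else 0) := Finset.single_le_sum hnn hiS
      calc ∑ x : ι → Bool, wt p x * (G t x * G t x)
          ≤ W - ∑ S ∈ 𝒮, a S * a S * ∑ x : ι → Bool, wt p x * (if Disjoint S ((T t).queried x) then (1 : ℝ) else 0) := by linarith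
        _ = ∑ S ∈ 𝒮, a S * a S * ∑ x : ι → Bool, wt p x * (if Disjoint S ((T t).queried x) then (0 : ℝ) else 1) := by
            rw [hW, ← Finset.sum_sub_distrib]
            exact Finset.sum_congr rfl hcompl
        _ ≤ ∑ S ∈ 𝒮, a S * a S * ∑ i ∈ S, ∑ x : ι → Bool, wt p x * (if i ∈ (T t).queried x then (1 : ℝ) else 0) :=
            Finset.sum_le_sum fun S hS => mul_le_mul_of_nonneg_left (hunion S hS) (mul_self_nonneg _)
    calc ∑ t, q t * ∑ x : ι → Bool, wt p x * (G t x * G t x)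
        ≤ ∑ t, q t * ∑ S ∈ 𝒮, a S * a S * ∑ i ∈ S, ∑ x : ι → Bool, wt p x * (if i ∈ (T t).queried x then (1 : ℝ) else 0) :=
          Finset.sum_le_sum fun t _ => mul_le_mul_of_nonneg_left (hP t) (hq0 t)
      _ = ∑ S ∈ 𝒮, a S * a S * ∑ i ∈ S, ∑ t, q t * ∑ x : ι → Bool, wt p x * (if i ∈ (T t).queried x then (1 : ℝ) else 0) := by
          simp only [Finset.mul_sum]
          rw [Finset.sum_comm]
          refine Finset.sum_congr rfl fun S _ => ?_
          rw [Finset.sum_comm]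
          exact Finset.sum_congr rfl fun i _ => Finset.sum_congr rfl fun t _ => by ring
      _ ≤ ∑ S ∈ 𝒮, a S * a S * ∑ i ∈ S, δ :=
          Finset.sum_le_sum fun S _ => mul_le_mul_of_nonneg_left (Finset.sum_le_sum fun i _ => hδ i) (mul_self_nonneg _)
      _ = k * δ * W := by
          rw [hW, Finset.mul_sum]
          refine Finset.sum_congr rfl fun S hS => ?_
          rw [Finset.sum_const, hcard S hS, nsmul_eq_mul]
          ring
  -- STEP 4: `2W = 2 Σ_t q_t E[f G_t] ≤ s E[f²] + Σ_t q_t E[G_t²]/s` and the choice `s = kδ`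
  have hA0 : 0 ≤ ∑ x : ι → Bool, wt p x * (f x * f x) := Finset.sum_nonneg fun x _ => mul_nonneg (hwt0 x) (mul_self_nonneg _)
  have hW0 : 0 ≤ W := by rw [hWdef]; exact Finset.sum_nonneg fun S _ => sq_nonneg _
  have hAMGM : ∀ s : ℝ, 0 < s → 2 * W ≤ s * (∑ x : ι → Bool, wt p x * (f x * f x)) + (k * δ * W) / s := by
    intro s hs
    have hWt : W = ∑ t, q t * ∑ x : ι → Bool, wt p x * (f x * G t x) := by
      simp_rw [step1]; rw [← Finset.sum_mul, hq1, one_mul]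
    have hpt : ∀ t (x : ι → Bool), q t * (wt p x * (2 * (f x * G t x)))
        ≤ q t * (wt p x * (s * (f x * f x) + (G t x * G t x) / s)) :=
      fun t x => mul_le_mul_of_nonneg_left (mul_le_mul_of_nonneg_left (two_mul_mul_le_of_pos hs _ _) (hwt0 x)) (hq0 t)
    have hsum := Finset.sum_le_sum fun t (_ : t ∈ (Finset.univ : Finset τ)) =>
      Finset.sum_le_sum fun x (_ : x ∈ (Finset.univ : Finset (ι → Bool))) => hpt t x
    have hl : ∑ t, ∑ x : ι → Bool, q t * (wt p x * (2 * (f x * G t x))) = 2 * W := by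
      rw [hWt, Finset.mul_sum]
      refine Finset.sum_congr rfl fun t _ => ?_
      rw [Finset.mul_sum, Finset.mul_sum]
      exact Finset.sum_congr rfl fun x _ => by ring
    have hr : ∑ t, ∑ x : ι → Bool, q t * (wt p x * (s * (f x * f x) + (G t x * G t x) / s))
        = s * (∑ x : ι → Bool, wt p x * (f x * f x)) + (∑ t, q t * ∑ x : ι → Bool, wt p x * (G t x * G t x)) / s := by
      have e1 : ∀ t, ∑ x : ι → Bool, q t * (wt p x * (s * (f x * f x) + (G t x * G t x) / s))
          = q t * (s * ∑ x : ι → Bool, wt p x * (f x * f x)) + (q t * ∑ x : ι → Bool, wt p x * (G t x * G t x)) / s := by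
        intro t
        have e2 : ∀ x : ι → Bool, q t * (wt p x * (s * (f x * f x) + (G t x * G t x) / s))
            = (q t * s) * (wt p x * (f x * f x)) + (q t / s) * (wt p x * (G t x * G t x)) := fun x => by ring
        simp_rw [e2]
        rw [Finset.sum_add_distrib, ← Finset.mul_sum, ← Finset.mul_sum]
        ring
      simp_rw [e1]
      rw [Finset.sum_add_distrib, ← Finset.sum_mul, hq1, one_mul, ← Finset.sum_div]
    rw [hl, hr] at hsum
    have hdiv : (∑ t, q t * ∑ x : ι → Bool, wt p x * (G t x * G t x)) / s ≤ (k * δ * W) / s :=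
      div_le_div_of_nonneg_right step3 hs.le
    linarith
  -- conclude
  change W ≤ k * δ * ∑ x : ι → Bool, wt p x * (f x * f x)
  by_cases hkδ : 0 < k * δ
  · have h := hAMGM (k * δ) hkδ
    have : (k : ℝ) * δ * W / (k * δ) = W := mul_div_cancel_left₀ W hkδ.ne'
    rw [this] at h
    linarith
  · -- `kδ = 0` (as `k ≥ 1`, `δ ≥ 0`): then `2W ≤ s·E[f²]` for every `s > 0`, so `W ≤ 0`
    have hkδ0 : (k : ℝ) * δ = 0 := le_antisymm (not_lt.1 hkδ) (mul_nonneg (Nat.cast_nonneg k) hδ0)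
    have hWle : ∀ s : ℝ, 0 < s → 2 * W ≤ s * ∑ x : ι → Bool, wt p x * (f x * f x) := by
      intro s hs
      have h := hAMGM s hs
      rw [hkδ0, zero_mul, zero_div, add_zero] at h
      exact h
    have hWz : W ≤ 0 := by
      by_contra hcon
      have hWpos : 0 < W := not_le.1 hcon
      by_cases hA : ∑ x : ι → Bool, wt p x * (f x * f x) = 0
      · have := hWle 1 one_pos
        rw [hA, mul_zero] at this
        linarith
      · have hApos : 0 < ∑ x : ι → Bool, wt p x * (f x * f x) := lt_of_le_of_ne hA0 (Ne.symm hA)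
        have := hWle (W / ∑ x : ι → Bool, wt p x * (f x * f x)) (div_pos hWpos hApos)
        rw [div_mul_cancel₀ _ hA] at this
        linarith
    rw [hkδ0, zero_mul]
    exact hWz

/-- **LOW LEVELS** (Schramm–Steif summed over `1 ≤ k ≤ m`): **`Σ_{k=1}^{m} Σ_{|S|=k} f̂(S)² ≤ m²·δ·E_p[f²]`** — a function computed by an
algorithm of small revealment has almost no Fourier weight on the levels `≤ m ≪ δ^{−1/2}`.
[cite: SchrammSteif2010, Thm 1.8 (summed over k)] [cite: GarbanSteif2014, Ch. VIII Cor VIII.2 / Prop IV.1 (spectrum below level m)] -/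
theorem low_level_weight_le_revealment (p : ι → ℝ) (h0 : ∀ i, 0 ≤ p i) (h1 : ∀ i, p i ≤ 1) {r : ι → Bool → ℝ}
    (hH1 : ∀ i, p i * r i true + (1 - p i) * r i false = 0)
    (hH2 : ∀ i (b b' : Bool), coordWt p i b ≠ 0 → coordWt p i b' * (1 + r i b * r i b') = if b' = b then 1 else 0)
    (f : (ι → Bool) → ℝ) {τ : Type*} [Fintype τ] (q : τ → ℝ) (hq0 : ∀ t, 0 ≤ q t) (hq1 : ∑ t, q t = 1)
    (T : τ → DecTree ι) (hT : ∀ t, (T t).Reduced) (hf : ∀ t x, (T t).eval x = f x) (m : ℕ) {δ : ℝ}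
    (hδ0 : 0 ≤ δ) (hδ : ∀ i, ∑ t, q t * ∑ x : ι → Bool, wt p x * (if i ∈ (T t).queried x then (1 : ℝ) else 0) ≤ δ) :
    ∑ k ∈ Finset.Icc 1 m, ∑ S ∈ (Finset.univ : Finset ι).powersetCard k,
        (∑ x : ι → Bool, wt p x * (f x * ∏ i ∈ S, r i (x i))) ^ 2
      ≤ (m : ℝ) ^ 2 * δ * ∑ x : ι → Bool, wt p x * (f x * f x) := by
  have hA0 : 0 ≤ ∑ x : ι → Bool, wt p x * (f x * f x) :=
    Finset.sum_nonneg fun x _ => mul_nonneg (wt_nonneg h0 h1 x) (mul_self_nonneg _)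
  calc ∑ k ∈ Finset.Icc 1 m, ∑ S ∈ (Finset.univ : Finset ι).powersetCard k, (∑ x : ι → Bool, wt p x * (f x * ∏ i ∈ S, r i (x i))) ^ 2
      ≤ ∑ k ∈ Finset.Icc 1 m, (m : ℝ) * δ * ∑ x : ι → Bool, wt p x * (f x * f x) := by
        refine Finset.sum_le_sum fun k hk => ?_
        obtain ⟨hk1, hkm⟩ := Finset.mem_Icc.1 hk
        refine (level_weight_le_revealment p h0 h1 hH1 hH2 f q hq0 hq1 T hT hf hk1 hδ0 hδ).trans ?_
        have : (k : ℝ) ≤ m := by exact_mod_cast hkm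
        exact mul_le_mul_of_nonneg_right (mul_le_mul_of_nonneg_right this hδ0) hA0
    _ = (m : ℝ) ^ 2 * δ * ∑ x : ι → Bool, wt p x * (f x * f x) := by
        rw [Finset.sum_const, Nat.card_Icc, nsmul_eq_mul]
        push_cast
        ring

end SchrammSteif

end Summit.CriticalPhenomena.PercolationContinuityZ3.Theorems.Crossing.Spectral

end
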